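import Literature.MathematicalPhysics.QuantumFieldTheory.Balaban1983to89.B6DomainChangeP2134Sizes
import Literature.MathematicalPhysics.QuantumFieldTheory.Balaban1983to89.B8Ineq192MultiLevelTorusL0
import HarnessLib
import Literature.MathematicalPhysics.QuantumFieldTheory.Balaban1983to89.B6Line3ProfileV1

/-!
# `Balaban1983to89.B6Line3ProfileV1L0` — LEVEL-0 TWIN (programme G-F3′-L0, director-ym LINE №27 / UV3-NODE §24.5; plan `lit-balaban-r03/G-F3L0-PLAN.md`) of `B6Line3ProfileV1`:
the same declarations, SAME NAMES AND STATEMENTS, for nested families WITH print's region `Λ₀ = T ∖ Ω₁` ADMITTED (structures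
`B6MultiLevelBoxOperatorL0.Domains` / `B6MultiLevelTorusOperatorL0.TDomains`: levels `0, …, k`, the level-`0` block a single site, `Q′₀ = id`,
finite weight `a₀` — print p.225 (2.14) «Σ_{j=0}^k … (Q′₀λ)(x) = λ(x), x ∈ Λ₀», p.229 «taking a sequence (2.1) … smallest possible domains B^j(Λ_j),
and considering the operator Δ_a defined by (2.19), (2.20) for this sequence»).  Every `D`-free object is the lineage's, consumed BY NAME; no existing
module is touched; no fact is minted.  Unit `lit-balaban-p33` (p33 gen 89; S-E entry twins named to p33 by the B6 owner r03 gen 36, ruling 2026-08-27T18:45:57Z; port tooling by r03 gen 36); B6 fold owner r03; referee ref-4.  THE TWIN'S DOCUMENTATION FOLLOWS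
VERBATIM (its «levels 1 … k» / «Ω₁ = X» sentences describe the twin; here `j` runs from `0` and `Ω₁` may be a proper subset).

# `Balaban1983to89.B6Line3ProfileV1` — T. Bałaban, *Propagators and renormalization transformations for lattice gauge theories. II*,
# Commun. Math. Phys. **96** (1984) 223–250 [Balaban1984PropagatorsII], Lemma 2.1 (2.61) p. 234 and p. 238: THE PROFILE `K_p` OF THE TORUS DISTANCE
# (2.46) FROM LEMMA 2.1, AND THE ABSORPTION OF THE LINE-3 CONSTANT `C_D(K_x)` INTO `e^{−cM}` — bookkeeping for the line-3 input of Prop. 2.6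

statement-level skeleton of published theorems with citation tags; proofs where landed; nothing here is a claim about the Yang–Mills mass gap

PDF held: `paper:balaban1984-cmp96-propagators-rt-ii` (journal page = PDF page + 222): p. 234 [PDF 12] (Lemma 2.1, (2.61): *"sup_y Σ_{y′∈𝔅} e^{−αδ₀d(y,y′)}
≤ c₁(α)"*), p. 233 [PDF 11] ((2.59)), p. 238 [PDF 16] (*"an estimate has the factor e^{−δ₀M} … gives a factor O(M⁻¹)"*).

CITATION HEADER (lean-in-tree rule) — WHAT IS REPRODUCED.  Phase-2 file of the `lit-balaban` typed skeleton (HOME `run/shared/lean/pub/lit-balaban/`),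
unit `lit-balaban-r03` (B6 fold owner; r03 gen 22, literature-prover-lit-balaban-r03-g22-0), referee ref-4.  SKELETON rows **B6.Lem2.1** × **B6.Prop2.6** ×
B6.Eq2.92 (cells; decls of record untouched).  Input of B6-CLOSURE §5 item 16: the binders `Kp`/`hPrT`/`hKp0`/`hKanti` of p22's
`…B6Line3WindowV1.line3_window` and the absorption of its constant `CDgk(…, K_p(1), K_p(δ′/192)·(1 + #𝔅(T_□)))·e^{−δ′M₀/96}` into `C_D·e^{−c_D M}`.
IMPORTS BY NAME, restating nothing: `…B6Geom246MultiLevelTorus` (p21: `geomT`, **`lemma21_torus`**), `…B6Ineq261LevelGap` (p29: `K261`, `K261_nonneg`),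
`…B6DomainChange` (p38: `Profile`), `…B6DomainChangeP2134Sizes` (p38: `CDgk`, `CDtot`), `…B8Ineq192MultiLevelTorus` (r05: `geomTB`).

## WHAT THIS FILE CERTIFIES (kernel-checked, 0 sorry, standard axioms; THEOREMS ONLY — no `def`, no new named fact)

* `budget_of_rate` — the (2.59)-shape threshold `e^{−a₀}·L^{2(d+1)/N₃} < 1` holds for `N₃ := ⌈2(d+1)·log L/a₀⌉₊ + 1`.
* `profile_torus` — **THE TORUS PROFILE**: under the Lemma-2.1 budget at rate `a₀`, the function `K_p(a) := K₂₆₁` for `a ≥ a₀`, `:= max(K₂₆₁, #𝔅)` below,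
  is a `Profile` of `(geomTB D).dist` (every `Σ_b e^{−a d_T(s,b)} ≤ K_p(a)`), non-negative and antitone on `a > 0` — the binders `hPrT`, `hKp0`, `hKanti`.
* `CDgk_mono` / `CDgk_scale` — p38's line-3 constant is monotone in `(θ₂, K_x)` and `C_D(s·K_x) ≤ s⁶·C_D(K_x)` for `s ≥ 1` (degree 6 in `K_x`).
* `pow_mul_exp_neg_le` / `poly_exp_absorb` — `x^q·e^{−2cx} ≤ q!·c^{−q}·e^{−cx}` and `(1 + A x^p)⁶·e^{−2cx} ≤ (1 + A)⁶(6p)!c^{−6p}·e^{−cx}` (`x ≥ 1`): the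
  polynomial block count of the member torus is absorbed into half of the exponential smallness (print's *"O(M⁻¹)"*, here `e^{−cM}`).

## HONEST SCOPE / DIVERGENCES

(1) The profile constant is p29/p21's `K261` of the torus Lemma 2.1 in reading R2 of (2.46) (G-B6-22), not print's `c₁(α)` (refuted as typed, B6.Lem2.1
cells).  (2) Pure bookkeeping; NOT summit progress.
-/

open scoped BigOperators

namespace Literature.MathematicalPhysics.QuantumFieldTheory.Balaban1983to89.B6Line3ProfileV1L0

open Finset
open B6MultiLevelTorusOperatorL0 (TDomains)
open B6Geom246MultiLevelBoxL0 (bset)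
open B6Geom246MultiLevelTorusL0 (geomT lemma21_torus)
open B8Ineq192MultiLevelTorusL0 (geomTB geomTB_dist)
open B6Ineq261LevelGap (K261 K261_nonneg)
open B6DomainChange (Profile)
open B6DomainChangeP2134Sizes (CDgk CDtot CDgk_nonneg)
open Literature.MathematicalPhysics.QuantumFieldTheory.Balaban1983to89.B6Line3ProfileV1 (budget_of_rate CDgk_mono CDgk_scale pow_mul_exp_neg_le poly_exp_absorb)

noncomputable section

variable {d : ℕ} {ℓ Mh k R : ℕ} {P : Fin (d + 1) → ℕ}

/-! ## §2  The torus profile from Lemma 2.1 (the twin's only `D`-dependent declaration; §1 `budget_of_rate`, §3 `CDgk_mono`/`CDgk_scale`,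
§4 `pow_mul_exp_neg_le`/`poly_exp_absorb` of the original are `D`-free and opened BY NAME above) -/

variable (D : TDomains d ℓ Mh k P R)

/-- **THE TORUS PROFILE `K_p` FROM LEMMA 2.1 (2.61)**: with `K := K₂₆₁(N₀, d+1, L, 1, a₀)` of the torus Lemma 2.1 at rate `a₀` (budget
`e^{−a₀}L^{2(d+1)/N₀} < 1`, `N₀ + 1 ≤ R·(L·M_h)`), the step function `K_p(a) = K` (`a ≥ a₀`), `= max(K, #𝔅)` (`a < a₀`) satisfies: every block sum
`Σ_b e^{−a d_T(s,b)} ≤ K_p(a)` (`a > 0`), `K_p ≥ 0`, `K_p` antitone — the binders `hPrT`, `hKp0`, `hKanti` of the line-3 window theorem.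
[cite: Balaban1984PropagatorsII, Lemma 2.1 (2.61) p.234; bookkeeping ours] -/
theorem profile_torus (hMh : 1 ≤ Mh) (hP : ∀ μ, 1 ≤ P μ) {N₀ : ℕ} (hN₀ : 0 < N₀) (hRM : N₀ + 1 ≤ R * ((ℓ + 1) * Mh)) {a₀ : ℝ} (ha₀ : 0 < a₀)
    (hθ : Real.exp (-(1 * a₀)) * ((ℓ : ℝ) + 1) ^ ((2 * (d + 1 : ℕ) : ℝ) / N₀) < 1) :
    Profile (B8Ineq192MultiLevelTorusL0.geomTB D).dist (fun a : ↥(bset D.toDomains) => a)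
        (fun a => if a₀ ≤ a then K261 N₀ (d + 1) ((ℓ : ℝ) + 1) 1 (1 * a₀)
          else max (K261 N₀ (d + 1) ((ℓ : ℝ) + 1) 1 (1 * a₀)) (Fintype.card ↥(bset D.toDomains))) ∧
      (∀ a : ℝ, 0 < a → 0 ≤ (if a₀ ≤ a then K261 N₀ (d + 1) ((ℓ : ℝ) + 1) 1 (1 * a₀)
          else max (K261 N₀ (d + 1) ((ℓ : ℝ) + 1) 1 (1 * a₀)) (Fintype.card ↥(bset D.toDomains)))) ∧
      (∀ a b : ℝ, 0 < a → a ≤ b →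
        (if a₀ ≤ b then K261 N₀ (d + 1) ((ℓ : ℝ) + 1) 1 (1 * a₀)
          else max (K261 N₀ (d + 1) ((ℓ : ℝ) + 1) 1 (1 * a₀)) (Fintype.card ↥(bset D.toDomains))) ≤
        (if a₀ ≤ a then K261 N₀ (d + 1) ((ℓ : ℝ) + 1) 1 (1 * a₀)
          else max (K261 N₀ (d + 1) ((ℓ : ℝ) + 1) 1 (1 * a₀)) (Fintype.card ↥(bset D.toDomains)))) := by
  set K : ℝ := K261 N₀ (d + 1) ((ℓ : ℝ) + 1) 1 (1 * a₀) with hK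
  have hK0 : 0 ≤ K := K261_nonneg (by positivity) zero_le_one
  -- Lemma 2.1 (2.61) on the torus at `α = 1`, `δ₀ = a₀`
  obtain ⟨-, h261, -, -⟩ := lemma21_torus (D := D) hMh hP hN₀ hRM ha₀.le zero_le_one le_rfl hθ
  have hd0 : ∀ s b : ↥(bset D.toDomains), 0 ≤ (geomTB D).dist s b := fun s b => by rw [geomTB_dist]; exact Nat.cast_nonneg _
  refine ⟨fun a ha s => ?_, fun a _ => ?_, fun a b ha hab => ?_⟩
  · show ∑ b : ↥(bset D.toDomains), Real.exp (-(a * (geomTB D).dist s b)) ≤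
      (if a₀ ≤ a then K else max K (Fintype.card ↥(bset D.toDomains) : ℝ))
    have hd0' : ∀ b : ↥(bset D.toDomains), 0 ≤ (geomTB D).dist s b := fun b => hd0 s b
    by_cases h : a₀ ≤ a
    · rw [if_pos h]
      calc ∑ b : ↥(bset D.toDomains), Real.exp (-(a * (geomTB D).dist s b))
          ≤ ∑ b : ↥(bset D.toDomains), Real.exp (-(1 * a₀ * (geomT D).dist s b)) :=
            Finset.sum_le_sum fun b _ => Real.exp_le_exp.2 (by
              have e : (geomT D).dist s b = (geomTB D).dist s b := rfl
              rw [e]; nlinarith [hd0' b])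
        _ ≤ K := h261 s
    · rw [if_neg h]
      calc ∑ b : ↥(bset D.toDomains), Real.exp (-(a * (geomTB D).dist s b)) ≤ ∑ _b : ↥(bset D.toDomains), (1 : ℝ) :=
            Finset.sum_le_sum fun b _ => by rw [Real.exp_le_one_iff]; nlinarith [hd0' b]
        _ = Fintype.card ↥(bset D.toDomains) := by simp
        _ ≤ max K (Fintype.card ↥(bset D.toDomains)) := le_max_right _ _
  · split_ifs
    · exact hK0
    · exact le_max_of_le_left hK0
  · by_cases hb : a₀ ≤ b
    · rw [if_pos hb]
      split_ifs
      · exact le_rfl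
      · exact le_max_left _ _
    · have ha' : ¬ a₀ ≤ a := fun h => hb (h.trans hab)
      rw [if_neg hb, if_neg ha']

end

end Literature.MathematicalPhysics.QuantumFieldTheory.Balaban1983to89.B6Line3ProfileV1L0
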